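import Summits.ResolutionOfSingularities.ResolutionOfSingularities.Theorems.EquisingularLiftEquisingularLiftNatTangentConeFibre
import Literature.AlgebraicGeometry.Resolution.PermissibleCentres
import Literature.AlgebraicGeometry.Resolution.MarkedIdealsLemmas
import Literature.AlgebraicGeometry.Resolution.MarkedIdealsArithmetic
import Literature.AlgebraicGeometry.Resolution.BlowupStalkEmbedding
import HarnessLib

/-!
# [OURS · L1 W4.5(b) · EL♮] (v) «THE SPECIAL FIBRE OF THE Δ-CENTRE»: `(St_τ(K) ⊔ E) · 𝒪_{F₂} = St_υ(K̄) ⊔ E₂` through the model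
# squares of T-ISO-0⁺ (res-L1-w45b-lead-2 08:14:45Z «(v) C.comap j₂ = Z», taken by res-D-pv-029)

Crux `EquisingularLiftNat` = stmt-ResolutionOfSingularities-20038 (child EL♮(3) = stmt-20148), route EquisingularLift, line `sections`;
helper file `--supports … --as helper`. HONEST FRAMING: OURS (cell res-hironaka, slot W4.5(b)); NOT a statement of any manuscript.
AI-written, weaker than expert review. No `sorry`; standard axioms.

THE INTERFACE LEMMA between res-type-100's T-CARRIER-Δ centre `C := St_τ(K) ⊔ E` (…NatCarrierDeltaStalks, p509910) and the
DOWNSTAIRS Δ-centre of T-ISO-0⁺ / T-INST (…NatDeltaPointResolutionStrong p514266, …NatTcDeltaPointResolution p515248):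

* `comap_strictTransformIdeal_sup_comap_eq_of_model` — SETTING: `τ : X₁ → X'` a blow-up along `J`, `υ : F₂ → F₁` a blow-up
  of the reduced closed point `x`, morphisms `j : F₁ → X'`, `j₂ : F₂ → X₁` with `j₂ ≫ τ = υ ≫ j` and `J · 𝒪_{F₁} = 𝔪_x` (the two
  MODEL SQUARES of T-ISO-0⁺ give exactly this: `modelPointStep_chain'`, p512154), `F₁, F₂` integral; the CONE HYPOTHESIS of
  T-CARRIER-Δ at `p = j x` (`J_p = (c)`, `c` quasi-regular, `𝒪/(c)` a domain, `K_p = (Φ(c))`, `Φ` a form of degree `d` with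
  `Φ̄ ≠ 0`) AND its image downstairs (`c̄ := j^♯_x ∘ c` quasi-regular in `𝒪_{F₁,x}`, the reduction of `Φ̄ := j^♯_x Φ` modulo
  `(c̄) = 𝔪_x` non-zero — i.e. `Φ ≢ 0 mod 𝔪_p`). CONCLUSION:
  **`(strictTransformIdeal τ J K ⊔ J.comap τ).comap j₂ = strictTransformIdeal υ 𝓘_{x} (K.comap j) ⊔ 𝓘_{x}.comap υ`** — the
  upstairs Δ-centre restricts to the downstairs Δ-centre of the REDUCED CONE `K̄ = K · 𝒪_{F₁}` (res-type-097's currency: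
  `strictTransformIdeal_sup_comap_eq_of_map_eq`, `coe_support_strictTransformIdeal_sup_comap_vanishingIdeal`, T-TCONE p514857 /
  p516084 then rewrite the right-hand side as `vanishingIdeal ⟨υ⁻¹{x} ∩ closure υ⁻¹(W ∖ {x})⟩` for the square-free initial form).

PROOF (no chart base change!): stalkwise (`ext_of_forall_stalkIdeal_eq`). Off `υ⁻¹{x}` both sides are `⊤`. At `y` over `x`,
res-type-100's stalk theorem (`exists_stalk_strictTransformIdeal_sup_comap`) is applied TWICE — upstairs at `j₂ y` (for `τ`) and
downstairs at `y` (for `υ`) — giving `(Φ(q), t)` and `(Φ̄(q′), t′)` in `A = 𝒪_{F₂,y}` for the two (a priori unrelated) chart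
presentations; but `(t) = (t′) = E₂_y`, so `t = u t′` with `u` a unit of the domain `A`, the chart fractions satisfy
`q_l t = a_l = q′_l t′` (`a_l` the image of `c_l`), hence `q′ = u • q`, and `Φ̄(u • q) = u^d Φ̄(q)` by homogeneity: the two ideals
coincide. The coefficient maps agree by `j₂ ≫ τ = υ ≫ j` (`Scheme.stalkMap_congr_hom`).

* helpers: `eval_smul_of_isHomogeneous'` (any commutative ring), `ne_zero_of_isQuasiRegular` (a member of a quasi-regular
  system generating a proper ideal is non-zero), `exists_stalk_carrierDelta_of_eq` (p-form of res-type-100's stalk theorem).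

References: …NatCarrierDeltaStalks (p509910), …NatTangentConeFibre (p514857), …NatModelChainStep (p512154); The Stacks Project,
Tag 0804; res-L1-w45b-lead-2 STATUS 2026-08-27T08:14:45Z (OURS planning text, index only).
-/

set_option linter.dupNamespace false -- mandated namespace `Summit.<Summit>.<Problem>` of this single-conjunct summit

noncomputable section

open CategoryTheory CategoryTheory.Limits AlgebraicGeometry TopologicalSpace Topology IsLocalRing
open Literature.AlgebraicGeometry.Resolution
open AlgebraicGeometry.Scheme.IdealSheafData

namespace Summit.ResolutionOfSingularities.ResolutionOfSingularities.Cruxes.EquisingularLiftNat.Sections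

universe u

/-! ## Helpers -/

/-- `φ(u • q) = u ^ d * φ(q)` for a form `φ` of degree `d` over any commutative ring. [folklore] -/
theorem eval_smul_of_isHomogeneous' {A : Type*} [CommRing A] {σ : Type*} {φ : MvPolynomial σ A} {d : ℕ}
    (hφ : φ.IsHomogeneous d) (u : A) (q : σ → A) :
    MvPolynomial.eval (u • q) φ = u ^ d * MvPolynomial.eval q φ := by
  classical
  conv_lhs => rw [φ.as_sum, map_sum]
  conv_rhs => rw [φ.as_sum, map_sum, Finset.mul_sum]
  refine Finset.sum_congr rfl fun e he => ?_
  rw [MvPolynomial.eval_monomial, MvPolynomial.eval_monomial]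
  have hdeg : d = ∑ i ∈ e.support, e i := hφ.degree_eq_sum_deg_support he
  simp only [Pi.smul_apply, smul_eq_mul, mul_pow]
  rw [Finsupp.prod_mul, hdeg, ← Finset.prod_pow_eq_pow_sum, Finsupp.prod, Finsupp.prod]
  ring

/-- A member of a quasi-regular system `c` with `(c) ≠ R` is non-zero. [folklore] -/
theorem ne_zero_of_isQuasiRegular {R : Type*} [CommRing R] {r : ℕ} {c : Fin r → R} (hc : IsQuasiRegular c)
    (hI : Ideal.span (Set.range c) ≠ ⊤) (i : Fin r) : c i ≠ 0 := by
  intro h0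
  have h := hc 1 (MvPolynomial.X i) (MvPolynomial.isHomogeneous_X _ i)
    (by rw [MvPolynomial.eval_X, h0]; exact Ideal.zero_mem _)
  rw [MvPolynomial.mem_map_C_iff] at h
  have h1 := h (Finsupp.single i 1)
  simp only [MvPolynomial.coeff_X] at h1
  exact hI ((Ideal.eq_top_iff_one _).mpr h1)

/-! ## res-type-100's stalk theorem with the cone data at a NAMED point `p = τ x'` -/

variable {X' X₁ : Scheme.{u}} {τ : X₁ ⟶ X'} {J : X'.IdealSheafData}

set_option maxHeartbeats 400000 in -- chart algebra `blowupAlgebra` = subalgebra of a localisation: slow unification (as p509910)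
/-- **p-form of `exists_stalk_strictTransformIdeal_sup_comap`** (p509910): the cone data may be given at a point `p` with
`τ x' = p`; the structure map `χ` of the chart presentation then extends `τ^♯_{x'}` composed with the canonical identification
`𝒪_{X',p} ≅ 𝒪_{X',τ x'}`. [cite: StacksProject, Tag 0804] -/
theorem exists_stalk_carrierDelta_of_eq [IsLocallyNoetherian X₁] (hτ : IsBlowup τ J) (K : X'.IdealSheafData) (x' : X₁) (p : X')
    (hp : τ x' = p) (hpJ : p ∈ (J.support : Set X')) {r : ℕ}
    (c : Fin r → X'.presheaf.stalk p) (hcJ : Ideal.span (Set.range c) = stalkIdeal J p) (hc : IsQuasiRegular c)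
    [IsDomain (X'.presheaf.stalk p ⧸ Ideal.span (Set.range c))]
    {d : ℕ} (Φ : MvPolynomial (Fin r) (X'.presheaf.stalk p)) (hΦd : Φ.IsHomogeneous d)
    (hΦ : MvPolynomial.map (Ideal.Quotient.mk (Ideal.span (Set.range c))) Φ ≠ 0)
    (hK : stalkIdeal K p = Ideal.span {MvPolynomial.eval c Φ}) :
    ∃ (jj : Fin r) (χ : blowupAlgebra (Ideal.span (Set.range c)) (c jj) →+* X₁.presheaf.stalk x'),
      (∀ a, χ (algebraMap _ _ a) = (τ.stalkMap x').hom ((X'.presheaf.stalkCongr (Inseparable.of_eq hp)).inv a)) ∧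
      stalkIdeal (J.comap τ) x' =
        Ideal.span {χ (algebraMap _ (blowupAlgebra (Ideal.span (Set.range c)) (c jj)) (c jj))} ∧
      stalkIdeal (strictTransformIdeal τ J K ⊔ J.comap τ) x' =
        Ideal.span {χ (MvPolynomial.aeval (blowupAlgebra.frac c jj) Φ)} ⊔
          Ideal.span {χ (algebraMap _ (blowupAlgebra (Ideal.span (Set.range c)) (c jj)) (c jj))} := by
  subst hp
  obtain ⟨jj, 𝔔, χ, e, hχ, -, -, hE, -, hC, -⟩ :=
    exists_stalk_strictTransformIdeal_sup_comap hτ K x' hpJ c hcJ hc Φ hΦd hΦ hK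
  refine ⟨jj, χ, fun a => ?_, hE, hC⟩
  rw [hχ]
  simp [TopCat.Presheaf.stalkCongr]

/-! ## (v): the Δ-centre restricts to the special fibre as the Δ-centre of the reduced cone -/

set_option maxHeartbeats 1600000 in -- two instances of the chart-algebra stalk theorem (each 400000 in p509910) plus stalk transport
/-- **(v) «the special fibre of the Δ-centre».** See the module docstring. [cite: StacksProject, Tag 0804] -/
theorem comap_strictTransformIdeal_sup_comap_eq_of_model {X' X₁ F₁ F₂ : Scheme.{0}} (τ : X₁ ⟶ X')
    (J K : X'.IdealSheafData) (hτ : IsBlowup τ J) [IsLocallyNoetherian X₁] [IsLocallyNoetherian F₂]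
    [IsIntegral F₁] [IsIntegral F₂] [IsLocallyNoetherian F₁]
    (j : F₁ ⟶ X') (υ : F₂ ⟶ F₁) (j₂ : F₂ ⟶ X₁) (hcomm : j₂ ≫ τ = υ ≫ j)
    (x : F₁) (hx : IsClosed ({x} : Set F₁))
    (hυ : IsBlowup υ (vanishingIdeal ⟨{x}, hx⟩)) (hJ : J.comap j = vanishingIdeal ⟨{x}, hx⟩)
    -- the cone data at `j x`
    {r : ℕ} (c : Fin r → X'.presheaf.stalk (j x)) (hcJ : Ideal.span (Set.range c) = stalkIdeal J (j x))
    (hc : IsQuasiRegular c) [IsDomain (X'.presheaf.stalk (j x) ⧸ Ideal.span (Set.range c))]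
    {d : ℕ} (Φ : MvPolynomial (Fin r) (X'.presheaf.stalk (j x))) (hΦd : Φ.IsHomogeneous d)
    (hΦ : MvPolynomial.map (Ideal.Quotient.mk (Ideal.span (Set.range c))) Φ ≠ 0)
    (hK : stalkIdeal K (j x) = Ideal.span {MvPolynomial.eval c Φ})
    -- its image downstairs
    (hcbar : IsQuasiRegular (fun i => (j.stalkMap x).hom (c i)))
    (hΦbar : MvPolynomial.map (Ideal.Quotient.mk (Ideal.span (Set.range fun i => (j.stalkMap x).hom (c i))))
      (MvPolynomial.map (j.stalkMap x).hom Φ) ≠ 0) :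
    (strictTransformIdeal τ J K ⊔ J.comap τ).comap j₂ =
      strictTransformIdeal υ (vanishingIdeal ⟨{x}, hx⟩) (K.comap j) ⊔ (vanishingIdeal ⟨{x}, hx⟩).comap υ := by
  classical
  -- the carrier identity `(J · 𝒪_{X₁}) · 𝒪_{F₂} = 𝔪_x · 𝒪_{F₂}`
  have hE : (J.comap τ).comap j₂ = (vanishingIdeal ⟨{x}, hx⟩ : F₁.IdealSheafData).comap υ := by
    rw [← hJ, ← Scheme.IdealSheafData.comap_comp, ← Scheme.IdealSheafData.comap_comp, hcomm]
  refine ext_of_forall_stalkIdeal_eq fun y => ?_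
  by_cases hy : υ y = x
  · subst hy
    have hτx' : τ (j₂ y) = j (υ y) := by
      rw [← Scheme.Hom.comp_apply, hcomm, Scheme.Hom.comp_apply]
    have hxJ : j (υ y) ∈ (J.support : Set X') := by
      have : υ y ∈ ((J.comap j).support : Set F₁) := by
        rw [hJ, Scheme.IdealSheafData.coe_support_vanishingIdeal]; rfl
      rw [Scheme.IdealSheafData.support_comap] at this
      exact this
    -- the downstairs cone data
    set cb : Fin r → F₁.presheaf.stalk (υ y) := fun i => (j.stalkMap (υ y)).hom (c i) with hcb
    set Φb : MvPolynomial (Fin r) (F₁.presheaf.stalk (υ y)) := MvPolynomial.map (j.stalkMap (υ y)).hom Φ with hΦb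
    have hrange : Set.range cb = (j.stalkMap (υ y)).hom '' Set.range c := by
      rw [hcb]; exact Set.range_comp _ _
    have hcbJ : Ideal.span (Set.range cb) = stalkIdeal (vanishingIdeal ⟨{υ y}, hx⟩ : F₁.IdealSheafData) (υ y) := by
      rw [← hJ, stalkIdeal_comap_eq_map_stalkMap, ← hcJ, Ideal.map_span, hrange]
    have hcb𝔪 : Ideal.span (Set.range cb) = maximalIdeal (F₁.presheaf.stalk (υ y)) := by
      rw [hcbJ, stalkIdeal_vanishingIdeal_singleton hx]
    haveI : IsDomain (F₁.presheaf.stalk (υ y) ⧸ Ideal.span (Set.range cb)) :=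
      isDomain_quotient_span_of_span_eq_maximalIdeal hcb𝔪
    have hΦbd : Φb.IsHomogeneous d := hΦd.map _
    have hevalb : (j.stalkMap (υ y)).hom (MvPolynomial.eval c Φ) = MvPolynomial.eval cb Φb := by
      rw [hΦb, MvPolynomial.eval_map, show MvPolynomial.eval c Φ = MvPolynomial.eval₂ (RingHom.id _) c Φ from rfl,
        MvPolynomial.eval₂_comp_left, RingHom.comp_id]
      rfl
    have hKb : stalkIdeal (K.comap j) (υ y) = Ideal.span {MvPolynomial.eval cb Φb} := by
      rw [stalkIdeal_comap_eq_map_stalkMap, hK, Ideal.map_span, Set.image_singleton, hevalb]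
    have hyJ : υ y ∈ ((vanishingIdeal ⟨{υ y}, hx⟩ : F₁.IdealSheafData).support : Set F₁) := by
      rw [Scheme.IdealSheafData.coe_support_vanishingIdeal]; rfl
    -- the two stalk presentations
    obtain ⟨jj, χ, hχ, hEu, hCu⟩ :=
      exists_stalk_carrierDelta_of_eq hτ K (j₂ y) (j (υ y)) hτx' hxJ c hcJ hc Φ hΦd hΦ hK
    obtain ⟨j', 𝔔', χ', e', hχ', -, -, hEd, -, hCd, -⟩ :=
      exists_stalk_strictTransformIdeal_sup_comap hυ (K.comap j) y hyJ cb hcbJ hcbar Φb hΦbd hΦbar hKb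
    -- everything in `A = 𝒪_{F₂,y}`
    set ψ : blowupAlgebra (Ideal.span (Set.range c)) (c jj) →+* F₂.presheaf.stalk y := (j₂.stalkMap y).hom.comp χ with hψ
    set t : F₂.presheaf.stalk y := ψ (algebraMap _ _ (c jj)) with ht
    set t' : F₂.presheaf.stalk y := χ' (algebraMap _ _ (cb j')) with ht'
    set q : Fin r → F₂.presheaf.stalk y := fun l => ψ (blowupAlgebra.frac c jj l) with hq
    set q' : Fin r → F₂.presheaf.stalk y := fun l => χ' (blowupAlgebra.frac cb j' l) with hq'
    -- the coefficient maps agree: `ψ ∘ alg = υ^♯ ∘ j^♯ = χ' ∘ alg ∘ j^♯`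
    have hcoef : ∀ a : X'.presheaf.stalk (j (υ y)),
        ψ (algebraMap _ _ a) = (υ.stalkMap y).hom ((j.stalkMap (υ y)).hom a) := by
      intro a
      rw [hψ, RingHom.comp_apply, hχ]
      have h1 : (j₂ ≫ τ).stalkMap y = (X'.presheaf.stalkCongr (.of_eq (by rw [hcomm]))).hom ≫ (υ ≫ j).stalkMap y :=
        Scheme.Hom.stalkMap_congr_hom _ _ hcomm y
      have h2 : ∀ z, (j₂.stalkMap y).hom ((τ.stalkMap (j₂ y)).hom z) = ((j₂ ≫ τ).stalkMap y).hom z := fun z => by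
        rw [Scheme.Hom.stalkMap_comp]; rfl
      have h3 : ((X'.presheaf.stalkCongr (.of_eq (by rw [hcomm]) : Inseparable ((j₂ ≫ τ) y) ((υ ≫ j) y))).hom)
          ((X'.presheaf.stalkCongr (Inseparable.of_eq hτx')).inv a) = a := by
        change ((X'.presheaf.stalkCongr (Inseparable.of_eq hτx')).inv ≫
          (X'.presheaf.stalkCongr (Inseparable.of_eq hτx')).hom) a = a
        rw [Iso.inv_hom_id]; rfl
      have h4 : ∀ b, ((υ ≫ j).stalkMap y).hom b = (υ.stalkMap y).hom ((j.stalkMap (υ y)).hom b) := fun b => by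
        rw [Scheme.Hom.stalkMap_comp]; rfl
      rw [h2, h1, CommRingCat.hom_comp, RingHom.comp_apply, ← h4]
      exact congrArg _ h3
    have hcoef' : ∀ a : X'.presheaf.stalk (j (υ y)),
        χ' (algebraMap _ _ ((j.stalkMap (υ y)).hom a)) = (υ.stalkMap y).hom ((j.stalkMap (υ y)).hom a) :=
      fun a => hχ' _
    -- `a_l = q_l * t = q'_l * t'`
    have hqt : ∀ l, q l * t = (υ.stalkMap y).hom ((j.stalkMap (υ y)).hom (c l)) := by
      intro l
      rw [hq, ht, ← map_mul, mul_comm, blowupAlgebra.algebraMap_mul_gen, hcoef]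
    have hqt' : ∀ l, q' l * t' = (υ.stalkMap y).hom ((j.stalkMap (υ y)).hom (c l)) := by
      intro l
      rw [hq', ht', ← map_mul, mul_comm, blowupAlgebra.algebraMap_mul_gen, hcoef']
    -- `(t) = (t') = E₂_y`, so `t = u * t'` with `u` a unit
    have hspan : Ideal.span {t} = Ideal.span {t'} := by
      have h1 : stalkIdeal ((vanishingIdeal ⟨{υ y}, hx⟩ : F₁.IdealSheafData).comap υ) y = Ideal.span {t} := by
        rw [← hE, stalkIdeal_comap_eq_map_stalkMap, hEu, Ideal.map_span, Set.image_singleton]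
        rfl
      rw [← h1, hEd]
    obtain ⟨u, hu⟩ : Associated t' t := (Ideal.span_singleton_eq_span_singleton.mp hspan).symm
    -- `t' ≠ 0`: a member of the quasi-regular `cb`, transported by the injective `υ^♯_y`
    have ht'0 : t' ≠ 0 := by
      rw [ht', hχ']
      intro h0
      have h1 : cb j' = 0 := hυ.stalkMap_injective y (h0.trans (map_zero _).symm)
      exact ne_zero_of_isQuasiRegular hcbar (by rw [hcb𝔪]; exact (maximalIdeal.isMaximal _).ne_top) j' h1
    -- `q' = u • q`
    have hqq : q' = (u : F₂.presheaf.stalk y) • q := by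
      funext l
      have h1 : q' l * t' = ((u : F₂.presheaf.stalk y) * q l) * t' := by
        rw [hqt', ← hqt l, ← hu]; ring
      simp only [Pi.smul_apply, smul_eq_mul]
      exact mul_right_cancel₀ ht'0 h1
    -- the two forms, evaluated
    set P : MvPolynomial (Fin r) (F₂.presheaf.stalk y) :=
      MvPolynomial.map ((υ.stalkMap y).hom.comp (j.stalkMap (υ y)).hom) Φ with hP
    have hPd : P.IsHomogeneous d := hΦd.map _
    have hψalg : ψ.comp (algebraMap _ (blowupAlgebra (Ideal.span (Set.range c)) (c jj))) =
        (υ.stalkMap y).hom.comp (j.stalkMap (υ y)).hom := RingHom.ext fun a => hcoef a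
    have hχ'alg : (χ'.comp (algebraMap _ (blowupAlgebra (Ideal.span (Set.range cb)) (cb j')))).comp
        (j.stalkMap (υ y)).hom = (υ.stalkMap y).hom.comp (j.stalkMap (υ y)).hom := RingHom.ext fun a => hcoef' a
    have hup : ψ (MvPolynomial.aeval (blowupAlgebra.frac c jj) Φ) = MvPolynomial.eval q P := by
      rw [MvPolynomial.aeval_def, MvPolynomial.eval₂_comp_left, hψalg, hP, MvPolynomial.eval_map]
      rfl
    have hdown : χ' (MvPolynomial.aeval (blowupAlgebra.frac cb j') Φb) =
        (u : F₂.presheaf.stalk y) ^ d * MvPolynomial.eval q P := by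
      rw [MvPolynomial.aeval_def, MvPolynomial.eval₂_comp_left, hΦb, MvPolynomial.eval₂_map, hχ'alg,
        ← MvPolynomial.eval_map, ← hP, ← eval_smul_of_isHomogeneous' hPd, ← hqq]
      rfl
    -- conclude at `y`
    rw [stalkIdeal_comap_eq_map_stalkMap, hCu, Ideal.map_sup, Ideal.map_span, Ideal.map_span,
      Set.image_singleton, Set.image_singleton, hCd]
    change Ideal.span {ψ _} ⊔ Ideal.span {t} = Ideal.span {χ' _} ⊔ Ideal.span {t'}
    rw [hup, hdown, Ideal.span_singleton_mul_left_unit (u.isUnit.pow d), hspan]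
  · -- off the exceptional locus both sides are the unit ideal
    have hyE : y ∉ ((vanishingIdeal ⟨{x}, hx⟩ : F₁.IdealSheafData).comap υ).support := by
      intro h
      have h' : y ∈ (((vanishingIdeal ⟨{x}, hx⟩ : F₁.IdealSheafData).comap υ).support : Set F₂) := h
      rw [Scheme.IdealSheafData.support_comap, TopologicalSpace.Closeds.coe_preimage, Scheme.IdealSheafData.coe_support_vanishingIdeal] at h'
      exact hy h'
    have hE2 : stalkIdeal ((vanishingIdeal ⟨{x}, hx⟩ : F₁.IdealSheafData).comap υ) y = ⊤ :=
      stalkIdeal_eq_top_of_not_mem_support hyE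
    have hR : stalkIdeal (strictTransformIdeal υ (vanishingIdeal ⟨{x}, hx⟩) (K.comap j) ⊔
        (vanishingIdeal ⟨{x}, hx⟩).comap υ) y = ⊤ := by
      rw [stalkIdeal_sup, hE2, sup_top_eq]
    have hL : stalkIdeal ((strictTransformIdeal τ J K ⊔ J.comap τ).comap j₂) y = ⊤ := by
      apply top_le_iff.mp
      rw [← hE2, ← hE]
      exact stalkIdeal_mono (Scheme.IdealSheafData.comap_mono j₂ le_sup_right) y
    rw [hL, hR]

end Summit.ResolutionOfSingularities.ResolutionOfSingularities.Cruxes.EquisingularLiftNat.Sections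

end
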